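import Summits.BirchSwinnertonDyer.Rank1Residual.AdditivePotMult.Descent
import Literature.NumberTheory.EllipticCurves.Rank1Residual.Typed.Basic
import HarnessLib

/-!
# Sketch — «inert θ-refinement»: half-descent from a real quadratic field with `p` INERT
(crux-ideate g18, seat 2, crux `AdditiveKolyvaginRoad.LevelKolyvaginSystemsAdditive` = stmt-BirchSwinnertonDyer-21396)

Idea card `inert-theta-refinement`. Residual of the crux above the bottom (tree, p638284 / p635192):
the W-all LOWER halves `Typed.MissingLowerBoundAt W p` for `E` (rank 1) and for its rank-0 twists, at an
ADDITIVE potentially supersingular prime `p ≥ 5` with NON-ABELIAN inertia (`e ∈ {3,4,6}`, `e ∤ p − 1`).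

LEVER. Over `ℚ_p` the representation `V_pE` is not trianguline (supercuspidal type); over the UNRAMIFIED
quadratic extension `ℚ_{p²}` the type becomes abelian (`e ∣ p² − 1`), `V_pE|G_{ℚ_{p²}}` is trianguline with
two Frobenius-conjugate non-critical refinements `N_θ, N_{θ^p}` (φ² = −p on `D_cris^L`, `t_N = 1 > t_H = 0`
off the formal-CM locus). Globally: base change to a REAL quadratic `F` with `p` inert (`F_𝔭 = ℚ_{p²}`).

THIS FILE (elementary, sorry-free): §1 the over-`F` lower half in Miller's currency (`LowerHalfOverAt`,
same currency as `AdditivePotMult.MissingPPartOverAt`); §2 the HALF-DESCENT theorem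
`missingLowerBoundAt_of_lowerHalfOver_of_upper_twist`: lower half for a model of `E_F` + Kato's UPPER
half for the twist `E^{(d_F)}` + Milne's identity (★) ⟹ `MissingLowerBoundAt W p`; §3 the Transfer
target `InertLowerHalf` (C⁺, a `Prop`; nothing asserted). BSD is not proved by this.
-/

noncomputable section

open scoped Classical

set_option linter.dupNamespace false

namespace Summit.BirchSwinnertonDyer.BirchSwinnertonDyer.Cruxes.LevelKolyvaginSystemsAdditive.InertThetaRefinement

open WeierstrassCurve Literature.NumberTheory.EllipticCurves
  Literature.NumberTheory.EllipticCurves.Rank1Residual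
  Literature.NumberTheory.EllipticCurves.Rank1Residual.Typed
  Summit.BirchSwinnertonDyer.Rank1Residual.AdditivePotMult

/-! ## §1 The lower half over a number field -/

section OverK

variable {K : Type*} [Field K] [NumberField K]

/-- The "IMC / Eisenstein" LOWER half of the `p`-part of BSD for a model `W'` over the number field `K`,
in Miller's currency: `#Ш(W'/K)_an` is a rational `q` with `ord_p q ≤ ord_p #Ш(W'/K)` (the `≤` half of
`AdditivePotMult.MissingPPartOverAt`). A predicate; nothing asserted. [folklore] -/
def LowerHalfOverAt (W' : WeierstrassCurve K) (p : ℕ) : Prop :=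
  ∃ q : ℚ, shaAnOver W' = (q : ℂ) ∧ padicValRat p q ≤ padicValNat p W'.shaOrder

omit [NumberField K] in
/-- The full `p`-part over `K` gives the lower half (bookkeeping). [folklore] -/
theorem lowerHalfOverAt_of_missingPPartOverAt [NumberField K] (W' : WeierstrassCurve K) (p : ℕ)
    (h : MissingPPartOverAt W' p) : LowerHalfOverAt W' p := by
  obtain ⟨q, hq, hv⟩ := h
  exact ⟨q, hq, hv.le⟩

end OverK

/-! ## §2 The half-descent theorem -/

section HalfDescent

variable (W : WeierstrassCurve ℚ) [W.IsElliptic] (p : ℕ) [Fact p.Prime]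
  (K : Type) [Field K] [NumberField K]
  (Wd : WeierstrassCurve ℚ) [Wd.IsElliptic] (W' : WeierstrassCurve K) [W'.IsElliptic]

/-- **HALF-DESCENT.** `K/ℚ` quadratic, `W'` a `K`-model of `E_K`, `Wd` a `ℚ`-model of the twist `E^{(d_K)}`,
all three `Ш` finite, Milne's Weil-restriction identity (★) `hWR` on the chosen models. Then the LOWER half
of BSD_p for `E_K` over `K` and the UPPER half for the twist `E^{(d_K)}` over `ℚ` (Kato's side) give the
LOWER half for `E` over `ℚ`:
`ord_p #Ш_an(E) = ord_p q' + ord_p #Ш(E) + ord_p #Ш(E^D) − ord_p #Ш(E_K) − ord_p #Ш_an(E^D) ≤ ord_p #Ш(E)`.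
Elementary from `AdditivePotMult.shaAnOver_mul_eq`. [folklore] -/
theorem missingLowerBoundAt_of_lowerHalfOver_of_upper_twist
    (hmod : hasEntireLFunction_rat) (h2 : Module.finrank ℚ K = 2)
    (hWd : ∃ C : VariableChange ℚ, C • W.quadraticTwist (NumberField.discr K : ℚ) = Wd)
    (hW' : ∃ C : VariableChange K, C • W.baseChange K = W')
    (hshaW : W.ShaFinite) (hshaD : Wd.ShaFinite) (hshaK : W'.ShaFinite)
    (hWR : (W'.shaOrder : ℝ) * W'.regulator * W'.bsdPeriod * (W'.tamagawaProduct : ℝ) /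
        (W'.torsionOrder : ℝ) ^ 2 = W.bsdRHS * Wd.bsdRHS)
    (hK : LowerHalfOverAt W' p) (hd : MissingUpperBoundAt Wd p) : MissingLowerBoundAt W p := by
  -- the degenerate case `#Ш_an(E) = 0` is trivially a lower bound
  by_cases h0 : shaAn W = 0
  · exact ⟨0, by simp [h0], by simp⟩
  obtain ⟨q', hq', hv'⟩ := hK
  obtain ⟨qd, hqd, hvd⟩ := hd
  -- (★)
  have hstar := shaAnOver_mul_eq W K Wd W' hmod h2 hWd hW' hshaW hshaD hshaK hWR
  have hsW : W.shaOrder ≠ 0 := (W.shaOrder_pos hshaW).ne'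
  have hsD : Wd.shaOrder ≠ 0 := (Wd.shaOrder_pos hshaD).ne'
  have hsK : W'.shaOrder ≠ 0 := (W'.shaOrder_pos hshaK).ne'
  have hqd0 : qd ≠ 0 := by
    intro hz
    rw [hz, Rat.cast_zero, shaAn_def, div_eq_zero_iff] at hqd
    rcases hqd with h | h
    · rcases mul_eq_zero.mp h with h | h
      · exact Wd.leadingLCoeff_ne_zero_holds (hmod Wd) h
      · exact (pow_ne_zero 2 (by exact_mod_cast Wd.torsionOrder_pos_holds.ne' :
          (Wd.torsionOrder : ℂ) ≠ 0)) h
    · rcases mul_eq_zero.mp h with h | h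
      · rcases mul_eq_zero.mp h with h | h
        · exact (by exact_mod_cast Wd.realPeriodRat_pos_holds.ne' : (Wd.realPeriodRat : ℂ) ≠ 0) h
        · exact (by exact_mod_cast Wd.tamagawaProduct_pos_holds.ne' :
            (Wd.tamagawaProduct : ℂ) ≠ 0) h
      · exact (by exact_mod_cast Wd.regulator_pos'.ne' : (Wd.regulator : ℂ) ≠ 0) h
  have hq'0 : q' ≠ 0 := by
    intro hz
    apply h0
    have h1 : shaAn W * shaAn Wd * (W'.shaOrder : ℂ) = 0 := by
      rw [← hstar, hq', hz]; simp
    rw [hqd] at h1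
    rcases mul_eq_zero.mp h1 with h | h
    · rcases mul_eq_zero.mp h with h | h
      · exact h
      · exact absurd (by exact_mod_cast h : qd = 0) hqd0
    · exact absurd (by exact_mod_cast h : W'.shaOrder = 0) hsK
  -- solve (★) for `#Ш_an(E)`
  set q : ℚ := q' * W.shaOrder * Wd.shaOrder / (W'.shaOrder * qd) with hq_def
  have hshaAn : shaAn W = (q : ℂ) := by
    have hden : (W'.shaOrder : ℂ) * (qd : ℂ) ≠ 0 :=
      mul_ne_zero (by exact_mod_cast hsK) (by exact_mod_cast hqd0)
    rw [hq_def]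
    push_cast
    rw [eq_div_iff hden, ← hqd, ← hq']
    linear_combination -hstar
  refine ⟨q, hshaAn, ?_⟩
  have hsWq : (W.shaOrder : ℚ) ≠ 0 := by exact_mod_cast hsW
  have hsDq : (Wd.shaOrder : ℚ) ≠ 0 := by exact_mod_cast hsD
  have hsKq : (W'.shaOrder : ℚ) ≠ 0 := by exact_mod_cast hsK
  rw [hq_def, padicValRat.div (mul_ne_zero (mul_ne_zero hq'0 hsWq) hsDq) (mul_ne_zero hsKq hqd0),
    padicValRat.mul (mul_ne_zero hq'0 hsWq) hsDq, padicValRat.mul hq'0 hsWq,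
    padicValRat.mul hsKq hqd0, padicValRat.of_nat, padicValRat.of_nat, padicValRat.of_nat]
  push_cast at hv' hvd ⊢
  linarith

end HalfDescent

/-! ## §3 The Transfer target C⁺ (a `Prop`; nothing asserted) -/

/-- **C⁺ = `InertLowerHalf`** (the statement the idea transfers the crux to). For `E/ℚ` (globally minimal
`W`) with ADDITIVE potentially good reduction at `p ≥ 5` (`Addv`, `ord_p j ≥ 0`) of NON-ABELIAN inertia type
(`e = 12/gcd(12, ord_p Δ) ∤ p − 1`), surjective mod-`p` image, `r_an(E) ≤ 1`; for every REAL quadratic field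
`K` in which `p` is INERT (`p ∤ d_K`, `d_K` a non-square mod `p`) whose twist `E^{(d_K)}` has analytic rank `0`;
for every `K`-model `W'` of `E_K` and `ℚ`-model `Wd` of the twist on which Milne's identity (★) holds:
the LOWER half of BSD_p for `E_K` over `K` — `ord_p #Ш(E_K)_an ≤ ord_p #Ш(E_K)`.
WHY EASIER than over `ℚ`: at the unique prime `𝔭 ∣ p` of `K`, `K_𝔭 = ℚ_{p²}` and `V_pE|G_{ℚ_{p²}}` is
trianguline with non-critical refinements, so refined (finite-slope) `p`-adic `L`-functions, Coleman maps and
an Eisenstein/IMC lower bound are available in kind (Bergdall–Hansen 2024; Wan 2015 needs `p` unramified — true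
here); none of these objects exists over `ℚ_p` for a supercuspidal `π_p`. [folklore] -/
def InertLowerHalf : Prop :=
  ∀ (W : WeierstrassCurve ℚ) [W.IsElliptic] [W.IsGloballyMinimal] (p : ℕ) [Fact p.Prime],
    5 ≤ p → Addv W p → 0 ≤ padicValRat p W.j →
    ¬ (12 / Nat.gcd 12 (padicValInt p W.minimalDiscriminantInt) ∣ p - 1) →
    W.HasSurjectiveModNGaloisRep p → W.analyticRank ≤ 1 →
    ∀ (K : Type) [Field K] [NumberField K], Module.finrank ℚ K = 2 → 0 < NumberField.discr K →
      ¬ (p : ℤ) ∣ NumberField.discr K → ¬ IsSquare ((NumberField.discr K : ℤ) : ZMod p) →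
      (W.quadraticTwist (NumberField.discr K : ℚ)).analyticRank = 0 →
    ∀ (Wd : WeierstrassCurve ℚ) [Wd.IsElliptic] (W' : WeierstrassCurve K) [W'.IsElliptic],
      (∃ C : VariableChange ℚ, C • W.quadraticTwist (NumberField.discr K : ℚ) = Wd) →
      (∃ C : VariableChange K, C • W.baseChange K = W') → W'.ShaFinite →
      (W'.shaOrder : ℝ) * W'.regulator * W'.bsdPeriod * (W'.tamagawaProduct : ℝ) /
          (W'.torsionOrder : ℝ) ^ 2 = W.bsdRHS * Wd.bsdRHS →
      LowerHalfOverAt W' p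

/-- **The deployment, typed**: C⁺ + Kato's upper half for the rank-0 twist + finiteness deliver the
over-`ℚ` lower half at `(E, p)` — a direct instance of the half-descent theorem (nothing new). [folklore] -/
theorem missingLowerBoundAt_of_inertLowerHalf (hC : InertLowerHalf) (hmod : hasEntireLFunction_rat)
    (W : WeierstrassCurve ℚ) [W.IsElliptic] [W.IsGloballyMinimal] (p : ℕ) [Fact p.Prime]
    (hp : 5 ≤ p) (hadd : Addv W p) (hj : 0 ≤ padicValRat p W.j)
    (hna : ¬ (12 / Nat.gcd 12 (padicValInt p W.minimalDiscriminantInt) ∣ p - 1))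
    (hsurj : W.HasSurjectiveModNGaloisRep p) (hr : W.analyticRank ≤ 1)
    (K : Type) [Field K] [NumberField K] (h2 : Module.finrank ℚ K = 2) (hreal : 0 < NumberField.discr K)
    (hpd : ¬ (p : ℤ) ∣ NumberField.discr K) (hinert : ¬ IsSquare ((NumberField.discr K : ℤ) : ZMod p))
    (hr0 : (W.quadraticTwist (NumberField.discr K : ℚ)).analyticRank = 0)
    (Wd : WeierstrassCurve ℚ) [Wd.IsElliptic] (W' : WeierstrassCurve K) [W'.IsElliptic]
    (hWd : ∃ C : VariableChange ℚ, C • W.quadraticTwist (NumberField.discr K : ℚ) = Wd)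
    (hW' : ∃ C : VariableChange K, C • W.baseChange K = W')
    (hshaW : W.ShaFinite) (hshaD : Wd.ShaFinite) (hshaK : W'.ShaFinite)
    (hWR : (W'.shaOrder : ℝ) * W'.regulator * W'.bsdPeriod * (W'.tamagawaProduct : ℝ) /
        (W'.torsionOrder : ℝ) ^ 2 = W.bsdRHS * Wd.bsdRHS)
    (hKato : MissingUpperBoundAt Wd p) : MissingLowerBoundAt W p :=
  missingLowerBoundAt_of_lowerHalfOver_of_upper_twist W p K Wd W' hmod h2 hWd hW' hshaW hshaD hshaK hWR
    (hC W p hp hadd hj hna hsurj hr K h2 hreal hpd hinert hr0 Wd W' hWd hW' hshaK hWR) hKato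

end Summit.BirchSwinnertonDyer.BirchSwinnertonDyer.Cruxes.LevelKolyvaginSystemsAdditive.InertThetaRefinement

end
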